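import Summits.ResolutionOfSingularities.ResolutionOfSingularities.Theorems.WeightedInvariantLocalWeightedDropNCEndgameGraphPos

/-!
# W4.3 `LocalWeightedDrop` — TOT rung R8: THE NC ENDGAME, PART 2 (Phase 1 and the theorem; imports PART 1 `…NCEndgameGraphPos`)

[OURS · L1 W4.3 · engine crux `LocalWeightedDrop` stmt-ResolutionOfSingularities-8899 · residual stub `stub_spaceNCRankDrop` (v32) ·
TOT2-LINE v1 unit S-END (the `o = 1` endgame).  Strategist sketch res-L1-w43-strat-1 gen 6 `tot_rung_r8_sketch.lean` sha16
0150fd6307e7f393 lines 394–680, adopted verbatim by res-D-pv-006 (S-END hand); closes no stub by name.  AI-produced, weaker than expert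
review; NOT a statement of the manuscript under review ([claim: Hironaka2017, status: under-review]).]

THE THEOREM (every field, no characteristic hypothesis): `exists_winsIn_orderOne_mul : f.order = 1 → constantCoeff u ≠ 0 →
∃ N, WinsIn (m := 2) GermIsNC N (u * f * ∏ l, X l ^ v l)`; corollary `exists_winsIn_orderOne_mul_prod` (the Finset form
`f * ∏ l ∈ E, X l` = S-SET's `Decoration.total` at `o = 1`, the binder `hR8` of `…TOT2EndBridge` at `m = 2`).

(N) NORMAL FORM: a linear letter `x_j` of `f` with `v_j = 0` makes the position NC at once (`germIsNC_of_smooth_mul_unitMonomial`);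
else permute `j` to the last slot (`rename (Equiv.swap j 2)`, a legal coordinate change: `isUnit_det_linMat_perm`) and
Weierstrass-prepare in degree `1` (`WeierstrassForm.exists_weierstrass`): up to a unit the position is
`x_2 ^ a · relBinom h102 1 ηm 1 φ = x_2 ^ a · ηm^L · (x_2 + φ^L)` with `ηm ≠ 0` a plane monomial and `φ ∈ 𝔪` a plane germ
(`φ = 0`: unit monomial, NC).  PHASE 1 (`winsIn_graphRel` = the R7 PHASE-A LIFT `…NCTameBinomialRung` with `d = 1`, `M = 1` and the
rider `x_2 ^ a`): play the PLANE game of `η · h` (`winsIn_plane`) lifted with weight `0` on `x_2` (`isCountMove_blockExtend`,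
`subst_chart_blockExtend_relBinom`, `not_X_dvd_liftBracket`, `X_mul_slice_liftTransform`, `saturation_unit_mul`): positions
`x_2 ^ a · relBinom 1 η 1 h` go to positions of the same shape, the new plane datum `η' · h'` divides a power of the plane successor
(`winsIn_of_dvd_pow_at`), and `ord h' ≤ 2 · ord h` by (O) `orderGrowth`.  When the plane game is won (`n = 0`), `η` and `h` are unit
monomials in common legal plane coordinates (`TrackC.exists_eq_unit_mul_monomial_of_dvd`); the block extension of those coordinates
(`subst_blockExtend_relBinom`, `winsIn_germIsNC_of_subst`) turns the position into a `graphPos` with monomial data: PHASE 2 (PART 1).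
BOUND: `2 ^ n · K + n` rounds for `n` plane rounds and `K ≥ ord h`.  PART 2 is def-free (kernel lane); PART 1 carries the two
defs `rz`, `graphPos` (review lane) — or inline `graphPos` and keep only `rz`.
-/

noncomputable section

open Literature.AlgebraicGeometry.Resolution

set_option linter.dupNamespace false -- mandated namespace of this single-conjunct summit

namespace Summit.ResolutionOfSingularities.ResolutionOfSingularities.Theorems

namespace NCTransport

open MvPowerSeries TameFourTupleDrop

variable {k : Type} [Field k]

/-! ## PHASE 1 — graph positions with arbitrary plane data: the lifted plane game -/

section Phase1

/-- Products over the one-letter right block. -/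
theorem prod_rz {M : Type} [CommMonoid M] (g : Fin (rz + 1) → M) : ∏ j, g j = g 0 := Fin.prod_univ_one g

/-- A block exponent vector: a plane monomial on the left block times a power of `x_2`. -/
theorem prod_pow_blockFun (ε : Fin (1 + 1) → ℕ) (N : ℕ) :
    (∏ l, (X l : MvPowerSeries (Fin (2 + 1)) k) ^ blockFun h102 ε (fun _ => N) l) =
      rename (bL h102) (∏ i, X i ^ ε i) * X (bR h102 0) ^ N := by
  rw [prod_block h102, prod_rz, map_prod]
  simp only [blockFun_bL, blockFun_bR, map_pow, rename_X]

/-- The slice of `1` is `1`. -/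
theorem slice_one {n : ℕ} (i : Fin (n + 1)) : TupleGame.slice i (1 : MvPowerSeries (Fin (n + 1 + 1)) k) = 1 := by
  unfold TupleGame.slice
  rw [← coe_substAlgHom (CobordantChartPlaneSlice.hasSubst_slice i), map_one]

/-- The relative binomial with `d = 1`, `M = 1` is the graph bracket: `relBinom 1 η 1 h = η^L · (x_2 + h^L)`. -/
theorem relBinom_one_eta_one (η h : MvPowerSeries (Fin (1 + 1)) k) :
    relBinom h102 1 η 1 h = rename (bL h102) η * (X (bR h102 0) + rename (bL h102) h) := by
  unfold relBinom
  simp only [map_one, one_mul, pow_one]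

/-- **PHASE 1 (the lifted plane game).**  From the graph position `x_2 ^ a · η^L · (x_2 + h^L)` (`η, h ≠ 0` plane germs) whose
plane product `η · h` is won by the plane mover within `n` rounds and with `ord h ≤ K`, the space mover wins within
`2 ^ n · K + n` rounds (the order potential at most doubles per round by (O); Phase 2 takes `≤ ord h` rounds at the end): it plays
the plane moves lifted with weight `0` on `x_2` (R7 Phase A with `d = 1`, `M = 1`), then Phase 2. -/
theorem winsIn_graphRel : ∀ (n K a : ℕ) (η h : MvPowerSeries (Fin (1 + 1)) k), η ≠ 0 → h ≠ 0 →
    (∃ oh : ℕ, h.order = oh ∧ oh ≤ K) → WinsIn (m := 1) GermIsNC n (η * h) →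
      WinsIn (m := 2) GermIsNC (2 ^ n * K + n) (X (bR h102 0) ^ a * relBinom h102 1 η 1 h) := by
  classical
  intro n
  induction n with
  | zero =>
    intro K a η h hη hh hpot hwin
    obtain ⟨oh, hoh, hK⟩ := hpot
    obtain ⟨Φ, u, γ, hΦ0, hdet, hu, hprod⟩ := hwin
    have hΦs : HasSubst Φ := hasSubst_of_constantCoeff_zero hΦ0
    have hdet' : IsUnit (FormalCoordChange.linMat Φ).det := hdet
    have hsubst : subst Φ (η * h) = subst Φ η * subst Φ h := by rw [← coe_substAlgHom hΦs, map_mul]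
    rw [hsubst] at hprod
    obtain ⟨vE, ε, hvE, hEeq⟩ := TrackC.exists_eq_unit_mul_monomial_of_dvd u hu γ (subst Φ η) ⟨subst Φ h, by rw [← hprod]⟩
    obtain ⟨vh, e, hvh, hheq⟩ := TrackC.exists_eq_unit_mul_monomial_of_dvd u hu γ (subst Φ h)
      ⟨subst Φ η, by rw [← hprod, mul_comm]⟩
    have hsh : e 0 + e 1 = oh := by
      have h1 := order_unit_mul_prod_X_pow hvh e
      rw [← hheq, order_subst_of_isUnit_det hΦ0 hdet', hoh, Fin.sum_univ_two] at h1
      exact_mod_cast h1.symm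
    -- the transported position is a graph position with monomial data
    have hbs : HasSubst (blockSubst h102 Φ X) :=
      hasSubst_of_constantCoeff_zero (constantCoeff_blockSubst h102 hΦ0 fun j => constantCoeff_X j)
    have hx : (X (bR h102 0) : MvPowerSeries (Fin (2 + 1)) k) ^ a = rename (bR h102) (X 0 ^ a) := by rw [map_pow, rename_X]
    have hrid : subst (blockSubst h102 Φ X) ((X (bR h102 0) : MvPowerSeries (Fin (2 + 1)) k) ^ a) = X (bR h102 0) ^ a := by
      rw [hx, subst_blockSubst_rename_bR h102 hΦ0 (fun j => constantCoeff_X j) (X 0 ^ a), subst_self, id_eq]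
    have hQ : subst (blockSubst h102 Φ X) (X (bR h102 0) ^ a * relBinom h102 1 η 1 h) =
        graphPos (rename (bL h102) vE) (blockFun h102 ε fun _ => a) (vh * ∏ i, X i ^ e i) := by
      rw [← coe_substAlgHom hbs, map_mul, coe_substAlgHom hbs, hrid, subst_blockExtend_relBinom h102 hΦ0 1 η 1 h, hEeq, hheq,
        ← coe_substAlgHom hΦs, map_one, relBinom_one_eta_one]
      unfold graphPos
      rw [prod_pow_blockFun, bR_zero_eq_two, map_mul]
      ring
    have hwinQ := winsIn_graphPos K (rename (bL h102) vE) (blockFun h102 ε fun _ => a) vh e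
      (by rw [constantCoeff_rename]; exact hvE) hvh (by omega)
    rw [← hQ] at hwinQ
    rw [show 2 ^ 0 * K + 0 = K by simp]
    exact winsIn_germIsNC_of_subst (constantCoeff_blockSubst h102 hΦ0 fun j => constantCoeff_X j)
      (by rw [det_linMat_blockSubst]; exact hdet.mul (isUnit_det_linMat_perm (Equiv.refl _))) _ _ hwinQ
  | succ n ih =>
    intro K a η h hη hh hpot hwin
    rcases hwin with hwin | ⟨Φ₁, w₁, hmv, hcl⟩
    · exact WinsIn.mono (calc 2 ^ n * K + n ≤ 2 ^ n * K + n + (2 ^ n * K + 1) := Nat.le_add_right _ _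
        _ = 2 ^ (n + 1) * K + (n + 1) := by ring) (ih K a η h hη hh hpot hwin)
    rw [show 2 ^ (n + 1) * K + (n + 1) = (2 ^ n * (2 * K) + n) + 1 by ring]
    refine winsIn_move (isCountMove_blockExtend h102 hmv) fun c hc hc0 A G hfac hG => ?_
    obtain ⟨hΦ0, hdet, hw1, -⟩ := hmv
    obtain ⟨oh, hoh, hK⟩ := hpot
    have hprz := MvPowerSeries.prime_X' k (0 : Fin (rz + 1))
    have hprime0 := MvPowerSeries.prime_X' k (0 : Fin (1 + 1))
    have hprime := MvPowerSeries.prime_X' k (0 : Fin (1 + 1 + 1))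
    have hPrime := MvPowerSeries.prime_X' k (0 : Fin (2 + 1 + 1))
    -- the exceptional point restricted to the left block
    have hcR : ∀ j, c (bR h102 j) = 0 := fun j => hc _ (by rw [blockFun_bR]; rfl)
    have hc₁ : ∀ i, w₁ i = 0 → c (bL h102 i) = 0 := fun i hi => hc _ (by rw [blockFun_bL]; exact hi)
    have hc₁0 : (fun i => c (bL h102 i)) ≠ 0 := by
      intro h0
      apply hc0
      funext l
      rcases block_cases h102 l with ⟨i, rfl⟩ | ⟨j, rfl⟩
      · exact congr_fun h0 i
      · exact hcR j
    -- the two plane transforms and their `s`-saturations; the transform of `1`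
    have hne : ∀ {F : MvPowerSeries (Fin (1 + 1)) k}, F ≠ 0 →
        subst (CobordantChart.chart w₁ fun i => c (bL h102 i)) (subst Φ₁ F) ≠ 0 := fun hF =>
      CobordantChart.subst_chart_ne_zero w₁ _ hc₁ (FormalCoordChange.subst_ne_zero_of_isUnit_det hΦ0 hdet hF)
    obtain ⟨aE, GE, hfacE, hGE⟩ := CobordantVertexChart.exists_eq_X_pow_mul_not_dvd (hne hη)
    obtain ⟨ah, Gh, hfach, hGh⟩ := CobordantVertexChart.exists_eq_X_pow_mul_not_dvd (hne hh)
    have hch₁ := CobordantChart.hasSubst_chart w₁ (fun i => c (bL h102 i)) hc₁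
    have hΦ₁s : HasSubst Φ₁ := hasSubst_of_constantCoeff_zero hΦ0
    have hfac1 : subst (CobordantChart.chart w₁ fun i => c (bL h102 i)) (subst Φ₁ (1 : MvPowerSeries (Fin (1 + 1)) k)) =
        X 0 ^ 0 * 1 := by
      rw [← coe_substAlgHom hΦ₁s, map_one, ← coe_substAlgHom hch₁, map_one, pow_zero, one_mul]
    have hG1 : ¬ X 0 ∣ (1 : MvPowerSeries (Fin (1 + 1 + 1)) k) := hprime.not_dvd_one
    -- the plane product transform
    have hfac₁ : subst (CobordantChart.chart w₁ fun i => c (bL h102 i)) (subst Φ₁ (η * h)) = X 0 ^ (aE + ah) * (GE * Gh) := by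
      rw [← coe_substAlgHom hΦ₁s, map_mul, coe_substAlgHom hΦ₁s, ← coe_substAlgHom hch₁, map_mul, coe_substAlgHom hch₁, hfacE,
        hfach]
      ring
    have hG₁ : ¬ X 0 ∣ GE * Gh := fun h' => (hprime.dvd_or_dvd h').elim hGE hGh
    -- the rider `x_2 ^ a` passes through unchanged
    have hbs : HasSubst (blockSubst h102 Φ₁ X) :=
      hasSubst_of_constantCoeff_zero (constantCoeff_blockSubst h102 hΦ0 fun j => constantCoeff_X j)
    have hch := CobordantChart.hasSubst_chart (blockFun h102 w₁ 0) c hc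
    have hx : (X (bR h102 0) : MvPowerSeries (Fin (2 + 1)) k) ^ a = rename (bR h102) (X 0 ^ a) := by rw [map_pow, rename_X]
    have hridΦ : subst (blockSubst h102 Φ₁ X) ((X (bR h102 0) : MvPowerSeries (Fin (2 + 1)) k) ^ a) =
        rename (bR h102) (X 0 ^ a) := by
      rw [hx, subst_blockSubst_rename_bR h102 hΦ0 (fun j => constantCoeff_X j) (X 0 ^ a), subst_self, id_eq]
    have hridc : subst (CobordantChart.chart (blockFun h102 w₁ 0) c) (rename (bR h102) ((X 0 : MvPowerSeries (Fin (rz + 1)) k) ^ a)) =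
        rename (bR (succ_hM h102)) (X 0 ^ a) :=
      subst_chart_rename_bR h102 hc (fun j => by rw [blockFun_bR]; rfl) (X 0 ^ a)
    -- the transform of the graph position: `s^aE · Big`
    have hprod : subst (CobordantChart.chart (blockFun h102 w₁ 0) c) (subst (blockSubst h102 Φ₁ X)
        (X (bR h102 0) ^ a * relBinom h102 1 η 1 h)) =
        X 0 ^ aE * (rename (bR (succ_hM h102)) (X 0 ^ a) * (rename (bL (succ_hM h102)) GE *
          (X 0 ^ 0 * rename (bL (succ_hM h102)) 1 * X (bR (succ_hM h102) 0) ^ 1 + X 0 ^ ah * rename (bL (succ_hM h102)) Gh))) := by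
      rw [← coe_substAlgHom hbs, map_mul, coe_substAlgHom hbs, hridΦ, ← coe_substAlgHom hch, map_mul, coe_substAlgHom hch, hridc,
        subst_chart_blockExtend_relBinom h102 hΦ0 hc 1 η 1 h, hfacE, hfac1, hfach]
      simp only [map_mul, map_pow, rename_bL_X_zero h102]
      ring
    have hGbig : ¬ X 0 ∣ rename (bR (succ_hM h102)) (X 0 ^ a) * (rename (bL (succ_hM h102)) GE *
        (X 0 ^ 0 * rename (bL (succ_hM h102)) 1 * X (bR (succ_hM h102) 0) ^ 1 + X 0 ^ ah * rename (bL (succ_hM h102)) Gh)) :=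
      fun h' => (hPrime.dvd_or_dvd h').elim (fun h1 => pow_ne_zero a hprz.ne_zero (eq_zero_of_X_dvd_rename_bR h102 h1))
        (fun h2 => (hPrime.dvd_or_dvd h2).elim (fun h3 => hGE (X_dvd_of_X_dvd_rename_bL h102 h3))
          (not_X_dvd_liftBracket h102 hG1 hGh (Or.inl rfl) one_ne_zero))
    have hsat : (1 : MvPowerSeries (Fin (2 + 1 + 1)) k) * (X 0 ^ aE * (rename (bR (succ_hM h102)) (X 0 ^ a) *
        (rename (bL (succ_hM h102)) GE * (X 0 ^ 0 * rename (bL (succ_hM h102)) 1 * X (bR (succ_hM h102) 0) ^ 1 +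
          X 0 ^ ah * rename (bL (succ_hM h102)) Gh)))) = X 0 ^ A * G := by rw [one_mul, ← hprod, hfac]
    obtain ⟨-, hGeq⟩ := saturation_unit_mul (by rw [map_one]; exact one_ne_zero) hGbig hG hsat
    -- the plane clause picks the live (left) slot
    obtain ⟨i₁, hci₁, hwin₁⟩ := hcl (fun i => c (bL h102 i)) hc₁ hc₁0 _ _ hfac₁ hG₁
    refine ⟨bL h102 i₁, hci₁, ?_⟩
    have hnew : X 0 * TupleGame.slice (bL h102 i₁) G =
        X (bR h102 0) ^ a * relBinom h102 1 (X 0 * TupleGame.slice i₁ GE) 1 (TupleGame.slice i₁ (X 0 ^ ah * Gh)) := by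
      rw [hGeq, one_mul, slice_mul, slice_bL_rename_bR h102, mul_left_comm, X_mul_slice_liftTransform h102 i₁ 0 ah 1, map_pow,
        rename_X, pow_zero, one_mul, slice_one]
    rw [hnew]
    -- the successors are non-zero
    have hsE0 := TupleDropAssembly.slice_ne_zero (subst Φ₁ η) w₁ _ hc₁ hw1 aE GE hfacE hGE i₁ hci₁
    have hsh0 := TupleDropAssembly.slice_ne_zero (subst Φ₁ h) w₁ _ hc₁ hw1 _ Gh hfach hGh i₁ hci₁
    have hE' : X 0 * TupleGame.slice i₁ GE ≠ 0 := mul_ne_zero hprime0.ne_zero hsE0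
    have hh' : TupleGame.slice i₁ (X 0 ^ ah * Gh) ≠ 0 := by
      rw [slice_mul, slice_pow, WildTerminal.slice_X_zero]; exact mul_ne_zero (pow_ne_zero _ hprime0.ne_zero) hsh0
    -- the potential at the successor: (O)
    obtain ⟨oh', hoh', hbh⟩ := orderGrowth (1 + 1) k (subst Φ₁ h) w₁ _
      (FormalCoordChange.subst_ne_zero_of_isUnit_det hΦ0 hdet hh) hc₁ hw1 _ Gh hfach hGh i₁ hci₁ oh
      (by rw [order_subst_of_isUnit_det hΦ0 hdet, hoh])
    have hpot' : ∃ oh₁ : ℕ, (TupleGame.slice i₁ (X 0 ^ ah * Gh)).order = (oh₁ : ℕ∞) ∧ oh₁ ≤ 2 * K :=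
      ⟨ah + oh', by rw [slice_mul, slice_pow, WildTerminal.slice_X_zero, order_X_pow_mul, hoh', Nat.cast_add], by omega⟩
    -- the plane product of the successors is won within `n` rounds (it divides a power of the plane clause's position)
    have hne₁ : X 0 * TupleGame.slice i₁ (GE * Gh) ≠ 0 :=
      mul_ne_zero hprime0.ne_zero (TupleDropAssembly.slice_ne_zero (subst Φ₁ (η * h)) w₁ _ hc₁ hw1 _ _ hfac₁ hG₁ i₁ hci₁)
    have hdvd : X 0 * TupleGame.slice i₁ GE * TupleGame.slice i₁ (X 0 ^ ah * Gh) ∣ (X 0 * TupleGame.slice i₁ (GE * Gh)) ^ (ah + 1) := by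
      rw [slice_mul, slice_mul, slice_pow, WildTerminal.slice_X_zero]
      exact ⟨(TupleGame.slice i₁ GE * TupleGame.slice i₁ Gh) ^ ah, by ring⟩
    have hwin' : WinsIn GermIsNC n (X 0 * TupleGame.slice i₁ GE * TupleGame.slice i₁ (X 0 ^ ah * Gh)) :=
      winsIn_of_dvd_pow_at ah (fun b' d' hd' hnc hdvd' => germIsNC_of_dvd_pow ah b' d' hd' hnc hdvd') n _ _ hne₁ hwin₁ hdvd
    exact ih (2 * K) a _ _ hE' hh' hpot' hwin'

end Phase1

/-! ## The endgame theorem -/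

/-- **R8 — THE NC ENDGAME.**  An order-`1` germ times any monomial in the coordinate letters (times a unit) is brought to
normal-crossing support by the mover of the NC count game in three variables within finitely many rounds, uniformly over the
exceptional points.  Every field, every characteristic. -/
theorem exists_winsIn_orderOne_mul (f u : MvPowerSeries (Fin (2 + 1)) k) (v : Fin (2 + 1) → ℕ) (hf : f.order = 1)
    (hu : constantCoeff u ≠ 0) : ∃ N, WinsIn (m := 2) GermIsNC N (u * f * ∏ l, X l ^ v l) := by
  classical
  obtain ⟨-, hfc, j, hj⟩ := exists_coeff_single_ne_zero_of_order_eq_one hf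
  by_cases hvj : v j = 0
  · -- a linear letter of `f` is unflagged: the position is already NC
    have h := germIsNC_of_smooth_mul_unitMonomial j hfc hj hu 1 hvj
    rw [pow_one] at h
    exact ⟨0, winsIn_done h 0⟩
  -- (N) permute the linear letter `x_j` to the last slot and Weierstrass-prepare in degree `1`
  obtain ⟨π, hπ⟩ : ∃ π : Equiv.Perm (Fin (2 + 1)), π = Equiv.swap j 2 := ⟨_, rfl⟩
  have hπj : π j = 2 := by rw [hπ, Equiv.swap_apply_left]
  have hππ : ∀ l, π (π l) = l := fun l => by rw [hπ]; exact Equiv.swap_apply_self _ _ _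
  have hf'c : constantCoeff (rename π f) = 0 := by rw [constantCoeff_rename]; exact hfc
  have hf'2 : coeff (Finsupp.single (Fin.last 2) 1) (rename π f) ≠ 0 := by
    have h := coeff_single_rename_self π.toEmbedding f j
    have h' : coeff (Finsupp.single (Fin.last 2) 1) (rename π f) = coeff (Finsupp.single j 1) f := by
      rw [← h, show (Fin.last 2 : Fin (2 + 1)) = π.toEmbedding j from hπj.symm]
      rfl
    rw [h']
    exact hj
  obtain ⟨H, A, hH, hA, hW⟩ := WeierstrassForm.exists_weierstrass (m := 2) (d := 1) (rename π f)
    (fun n hn => by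
      obtain rfl : n = 0 := by omega
      rw [Finsupp.single_zero, MvPowerSeries.coeff_zero_eq_constantCoeff]
      exact hf'c) hf'2
  -- `rename π f = H · (x_2 + φ(x_0, x_1))`
  have hemb : (⇑(Fin.succAboveEmb (Fin.last 2)) : Fin 2 → Fin (2 + 1)) = ⇑(bL h102) := by
    funext i
    show (Fin.last 2).succAbove i = bL h102 i
    rw [Fin.succAbove_last]
    exact Fin.ext rfl
  have hren : ∀ p : MvPowerSeries (Fin 2) k, rename (Fin.succAboveEmb (Fin.last 2)) p = rename (bL h102) p := fun p => by
    rw [rename_eq_subst, rename_eq_subst, hemb]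
  have hW' : rename π f = H * (X (bR h102 0) + rename (bL h102) (A 0)) := by
    rw [hW, Fin.sum_univ_one, hren, bR_zero_eq_two]
    simp only [Fin.val_zero, pow_zero, pow_one, mul_one]
    rfl
  -- the flagged letters: a plane monomial `ηm` on the left block and `x_2 ^ a`
  have hmon1 : rename π (∏ l, (X l : MvPowerSeries (Fin (2 + 1)) k) ^ v l) = ∏ l, X l ^ v (π l) := by
    rw [map_prod]
    simp only [map_pow, rename_X]
    calc (∏ l, (X (π l) : MvPowerSeries (Fin (2 + 1)) k) ^ v l)
        = ∏ l, (fun l' => (X l' : MvPowerSeries (Fin (2 + 1)) k) ^ v (π l')) (π l) :=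
          Finset.prod_congr rfl fun l _ => by simp only [hππ]
      _ = ∏ l, X l ^ v (π l) := Equiv.prod_comp π (fun l' => (X l' : MvPowerSeries (Fin (2 + 1)) k) ^ v (π l'))
  have hmon : rename π (∏ l, (X l : MvPowerSeries (Fin (2 + 1)) k) ^ v l) =
      rename (bL h102) (∏ i, X i ^ v (π (bL h102 i))) * X (bR h102 0) ^ v (π (bR h102 0)) := by
    rw [hmon1, prod_block h102 (fun l => (X l : MvPowerSeries (Fin (2 + 1)) k) ^ v (π l)), prod_rz, map_prod]
    simp only [map_pow, rename_X]
  have hηm : (∏ i, (X i : MvPowerSeries (Fin (1 + 1)) k) ^ v (π (bL h102 i))) ≠ 0 :=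
    Finset.prod_ne_zero_iff.mpr fun i _ => pow_ne_zero _ (MvPowerSeries.prime_X' k i).ne_zero
  have hunit : constantCoeff (rename π u * H) ≠ 0 := by
    rw [map_mul, constantCoeff_rename]; exact mul_ne_zero hu hH
  -- the permuted position is a unit times a graph position
  have hpos : rename π (u * f * ∏ l, X l ^ v l) = (rename π u * H) *
      (X (bR h102 0) ^ v (π (bR h102 0)) * relBinom h102 1 (∏ i, X i ^ v (π (bL h102 i))) 1 (A 0)) := by
    rw [map_mul, map_mul, hW', hmon, relBinom_one_eta_one]
    ring
  have key : ∃ N, WinsIn (m := 2) GermIsNC N ((rename π u * H) *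
      (X (bR h102 0) ^ v (π (bR h102 0)) * relBinom h102 1 (∏ i, X i ^ v (π (bL h102 i))) 1 (A 0))) := by
    by_cases hφ : A 0 = 0
    · -- `rename π f = H · x_2`: the position is a unit monomial
      refine ⟨0, winsIn_done ?_ 0⟩
      have heq : (rename π u * H) * (X (bR h102 0) ^ v (π (bR h102 0)) * relBinom h102 1 (∏ i, X i ^ v (π (bL h102 i))) 1 (A 0)) =
          (rename π u * H) * ∏ l, X l ^ blockFun h102 (fun i => v (π (bL h102 i))) (fun _ => v (π (bR h102 0)) + 1) l := by
        rw [prod_pow_blockFun, relBinom_one_eta_one, hφ]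
        simp only [map_zero, add_zero, pow_succ]
        ring
      rw [heq]
      exact germIsNC_unitMonomial hunit _
    · obtain ⟨n, hn⟩ := winsIn_plane k ((∏ i, (X i : MvPowerSeries (Fin (1 + 1)) k) ^ v (π (bL h102 i))) * A 0) (mul_ne_zero hηm hφ)
      obtain ⟨oφ, hoφ⟩ : ∃ o : ℕ, (A 0).order = o := ⟨(A 0).order.toNat, (ne_zero_iff_order_finite.mp hφ).symm⟩
      exact ⟨_, winsIn_germIsNC_unit_mul _ _ _ hunit (winsIn_graphRel n oφ _ _ (A 0) hηm hφ ⟨oφ, hoφ, le_rfl⟩ hn)⟩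
  obtain ⟨N, hN⟩ := key
  rw [← hpos, rename_eq_subst] at hN
  exact ⟨N, winsIn_germIsNC_of_subst (fun l => constantCoeff_X _) (isUnit_det_linMat_perm π) _ _ hN⟩

/-- THE FLAGGED FORM (= S-SET's `Decoration.total` at `o = 1`): an order-`1` germ times the product of any set of coordinate
letters is won within finitely many rounds. -/
theorem exists_winsIn_orderOne_mul_prod (f : MvPowerSeries (Fin (2 + 1)) k) (hf : f.order = 1) (E : Finset (Fin (2 + 1))) :
    ∃ N, WinsIn (m := 2) GermIsNC N (f * ∏ l ∈ E, X l) := by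
  classical
  obtain ⟨N, hN⟩ := exists_winsIn_orderOne_mul f 1 (fun l => if l ∈ E then 1 else 0) hf (by rw [map_one]; exact one_ne_zero)
  refine ⟨N, ?_⟩
  have h : (∏ l, (X l : MvPowerSeries (Fin (2 + 1)) k) ^ (if l ∈ E then 1 else 0)) = ∏ l ∈ E, X l := by
    rw [← Fintype.prod_ite_mem E (fun l => (X l : MvPowerSeries (Fin (2 + 1)) k))]
    exact Finset.prod_congr rfl fun l _ => by split_ifs <;> simp
  rwa [one_mul, h] at hN

end NCTransport

end Summit.ResolutionOfSingularities.ResolutionOfSingularities.Theorems
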